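import Summits.HodgeConjecture.HodgeConjecture.Theorems.AnchorTransportVariationalHodgePadicComposition
import Summits.HodgeConjecture.HodgeConjecture.Theorems.AnchorTransportVariationalHodgePadicModelSupply
import Summits.HodgeConjecture.HodgeConjecture.Theorems.AnchorTransportVariationalHodgeReductions
import Literature.AlgebraicGeometry.HodgeTheory.NonGenericComplexPointsCountable
import Literature.AlgebraicGeometry.Motives.ComplexPointsUncountable

/-!
# Route AnchorTransport — crux `VariationalHodge` (stmt-HodgeConjecture-1076), line `padic-disc-transport`:
# the SANDWICH for the arithmetic disc — `V ⟹ S`, hence `HC ⟹ S`, and `P ⟹ (V ↔ S)`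

HONEST FRAMING: research route conditional on HC_CM; not a corollary; Q11.4-sentence-2 already refuted in dim ≥ 3.
Helper file on the crux item (nothing here closes it; no definition, no named fact, no `sorry`;
`HC_CM` does not occur). Cell `pub-hodge-ring2`, binder seat `ring2-b03` (gen 37), BINDER-OWNERS row b03.

STUB S of the registered skeleton (`PadicDiscTransport.ArithmeticDiscSupply`, the Maulik–Poonen disc) is an
EXISTENTIAL statement whose last conjunct is an implication «`ξ̂|_{Y_κ}` algebraizes ⟹ `A|_{X_s}` is
algebraic». This file records, in the kernel, where S sits relative to the crux:

* `arithmeticDiscSupply_of_variationalHodgeDescended` — **the descended crux implies S**: at a `k`-GENERIC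
  complex point `s` (one exists: the complex points of the smooth base curve are uncountable,
  `Motives.ComplexPoints.not_countable_of_smoothOfRelativeDimension`, while the non-generic ones over a
  countable `k` are countable, `HodgeTheory.exists_weilGeneric_of_not_countable_of_complexification`) take
  the `W(𝔽̄_q)`-model of the fibre `X_s` supplied by `padicModelSupply` (gen 33; Cassels–Witt embedding +
  spreading out), the ZERO pro-class, and discharge the implication by the crux itself;
* `arithmeticDiscSupply_of_variationalHodge`, `arithmeticDiscSupply_of_hodgeConjecture` — hence **`V ⟹ S`**
  and **`HC ⟹ S`** (`variationalHodge_of_hodgeConjecture`): like the crux, S is HC-sandwiched on the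
  positive side — it cannot be refuted without refuting the Hodge conjecture (bookkeeping for the crux's
  `Disproof.lean` §1, which records the same for the crux: no stub of this line is refutable on truth
  over `ℂ` except the bet P, which lives over `W(𝔽̄_p)`);
* `variationalHodge_iff_arithmeticDiscSupply_of_padic` — with the composition `variationalHodge_of_padic`
  (gen 37, `P ∧ S ⟹ V`): **granted the p-adic bet P (AMMN 2022 Conj. 1.3, `K₀`-form), the variational Hodge
  conjecture is EQUIVALENT to the arithmetic disc statement S.**

What is NOT claimed: S itself (its C-free arithmetic part is in the kernel on quasi-projective carriers,
gens 33–36; its transport core `T` needs a crystalline ↔ de Rham ↔ Betti comparison package the tree does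
not have); P (research-open); any case of HC or of V.

References: [MaulikPoonen2012] §4; [AntieauMathewMorrowNikolaus2022] Conj. 1.3, Thm. D;
[CharlesSchnell2014Notes] Conj. 11.3.1, Cor. 11.3.6; [Cassels1976] Thm. I; [SerreGAGA1956] §2 n°5.
-/

noncomputable section

-- every declaration of this problem lives in `Summit.HodgeConjecture.HodgeConjecture.…` (summit = sub-problem)
set_option linter.dupNamespace false

open CategoryTheory AlgebraicGeometry TopologicalSpace
open Literature.AlgebraicGeometry.Motives Literature.AlgebraicGeometry.HodgeTheory
open Literature.AlgebraicGeometry.KTheory Literature.AlgebraicGeometry.Crystalline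
open Summit.HodgeConjecture.HodgeConjecture.Theses.AnchorTransport
open scoped Isocrystal

namespace Summit.HodgeConjecture.HodgeConjecture.Theorems

section Sandwich

/-- **The descended crux implies STUB S** (`ArithmeticDiscSupply`, binders verbatim with `IsGenericPoint` /
`ProClassAlgebraizes` unfolded). Witness: a `k`-generic complex point `s` of the base curve (uncountably many
complex points, countably many non-generic ones), the `W(𝔽̄_q)`-model `𝒴` of `X_s` with `q ≥ N` from
`padicModelSupply`, the zero pro-class; the implication holds because its conclusion does (the descended
crux at `s`, from the anchor `s₀`). [cite: MaulikPoonen2012, §4] [cite: SerreGAGA1956, §2 n°5 Prop. 2] -/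
theorem arithmeticDiscSupply_of_variationalHodgeDescended
    (hV : ∀ (k : Type) [Field k] [Countable k] (σ : k →+* ℂ) ⦃n : ℕ⦄ ⦃𝒳₀ S₀ : SchemeOver k⦄
      (f₀ : 𝒳₀ ⟶ S₀),
      IsSmoothProjectiveFamily ((baseChangeHom σ).map f₀) n →
      IrreducibleSpace ((baseChangeHom σ).obj S₀).left → IsAffine ((baseChangeHom σ).obj S₀).left →
      AlgebraicGeometry.Smooth ((baseChangeHom σ).obj S₀).hom →
      topologicalKrullDim ((baseChangeHom σ).obj S₀).left = 1 →
      ∀ (p : ℕ) (A : complexBetti ((baseChangeHom σ).obj 𝒳₀) (2 * p)),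
      (∀ s : ComplexPoints ((baseChangeHom σ).obj S₀),
        IsRationalClass (complexBetti.map (fiberι ((baseChangeHom σ).map f₀) s) (2 * p) A) ∧
        IsOfHodgeType n (fiberOver ((baseChangeHom σ).map f₀) s) (2 * p) p p
          (complexBetti.map (fiberι ((baseChangeHom σ).map f₀) s) (2 * p) A)) →
      (∃ s₀ : ComplexPoints ((baseChangeHom σ).obj S₀),
        complexBetti.map (fiberι ((baseChangeHom σ).map f₀) s₀) (2 * p) A ∈
          algebraicClasses (fiberOver ((baseChangeHom σ).map f₀) s₀) p) →
      ∀ s : ComplexPoints ((baseChangeHom σ).obj S₀),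
        complexBetti.map (fiberι ((baseChangeHom σ).map f₀) s) (2 * p) A ∈
          algebraicClasses (fiberOver ((baseChangeHom σ).map f₀) s) p) :
    ∀ (N : ℕ) (k : Type) [Field k] [Countable k] (σ : k →+* ℂ) ⦃n : ℕ⦄ ⦃𝒳₀ S₀ : SchemeOver k⦄
      (f₀ : 𝒳₀ ⟶ S₀),
      IsSmoothProjectiveFamily ((baseChangeHom σ).map f₀) n →
      IrreducibleSpace ((baseChangeHom σ).obj S₀).left → IsAffine ((baseChangeHom σ).obj S₀).left →
      AlgebraicGeometry.Smooth ((baseChangeHom σ).obj S₀).hom →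
      topologicalKrullDim ((baseChangeHom σ).obj S₀).left = 1 →
      ∀ (p : ℕ) (A : complexBetti ((baseChangeHom σ).obj 𝒳₀) (2 * p)),
      (∀ s : ComplexPoints ((baseChangeHom σ).obj S₀),
        IsRationalClass (complexBetti.map (fiberι ((baseChangeHom σ).map f₀) s) (2 * p) A) ∧
        IsOfHodgeType n (fiberOver ((baseChangeHom σ).map f₀) s) (2 * p) p p
          (complexBetti.map (fiberι ((baseChangeHom σ).map f₀) s) (2 * p) A)) →
      ∀ s₀ : ComplexPoints ((baseChangeHom σ).obj S₀),
        complexBetti.map (fiberι ((baseChangeHom σ).map f₀) s₀) (2 * p) A ∈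
          algebraicClasses (fiberOver ((baseChangeHom σ).map f₀) s₀) p →
      ∃ (q : ℕ) (_ : Fact q.Prime) (κ : Type) (_ : Field κ) (_ : CharP κ q) (_ : PerfectRing κ q)
        (_ : IsAlgClosed κ) (_ : Algebra (ZMod q) κ) (_ : Algebra.IsAlgebraic (ZMod q) κ)
        (𝒴 : SchemeOver (WittVector q κ))
        (ξ : ContinuousKZeroRat (Ideal.span {(q : WittVector q κ)}) 𝒴)
        (s : ComplexPoints ((baseChangeHom σ).obj S₀)) (ι : K(q, κ) →+* ℂ),
        N ≤ q ∧ WittScheme.IsSmoothProperModel n 𝒴 ∧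
        (∀ Z : Set (ComplexPoints ((baseChangeHom σ).obj S₀)),
          IsDefinedOver σ S₀ σ.fieldRange Z → s ∈ Z → Z = Set.univ) ∧
        Nonempty ((baseChangeHom ι).obj (WittScheme.genericFibre 𝒴) ≅
          fiberOver ((baseChangeHom σ).map f₀) s) ∧
        ((∃ η : KZeroRat 𝒴.left,
          KZeroRat.map (WittScheme.specialFibreι 𝒴) η =
            KZeroRat.map (specialFibreToTower 𝒴)
              (ContinuousKZeroRat.specialFibre (Ideal.span {(q : WittVector q κ)}) 𝒴 ξ)) →
          complexBetti.map (fiberι ((baseChangeHom σ).map f₀) s) (2 * p) A ∈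
            algebraicClasses (fiberOver ((baseChangeHom σ).map f₀) s) p) := by
  intro N k _ _ σ n 𝒳₀ S₀ f₀ hf hirr haff hsm hdim p A hA s₀ hs₀
  haveI := hirr
  haveI := haff
  haveI := hsm
  haveI : LocallyOfFiniteType ((baseChangeHom σ).obj S₀).hom := inferInstance
  haveI : SmoothOfRelativeDimension 1 ((baseChangeHom σ).obj S₀).hom :=
    Ring2.Hypotheses.smoothOfRelativeDimension_one_of_topologicalKrullDim _ hdim
  -- (1) a `k`-generic complex point: `S(ℂ)` is uncountable, the non-generic points are countable
  have huniv : ¬ (Set.univ : Set (ComplexPoints ((baseChangeHom σ).obj S₀))).Countable := by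
    intro h
    haveI : Countable (ComplexPoints ((baseChangeHom σ).obj S₀)) := Set.countable_univ_iff.1 h
    exact ComplexPoints.not_countable_of_smoothOfRelativeDimension ((baseChangeHom σ).obj S₀) 1
      Nat.one_pos s₀ inferInstance
  obtain ⟨s, -, hgen⟩ :=
    exists_weilGeneric_of_not_countable_of_complexification σ S₀ hdim.le huniv
  -- (2) the `W(𝔽̄_q)`-model of the generic fibre `X_s`, `q ≥ N`
  obtain ⟨q, hq, κ, hκF, hκC, hκP, hκA, hκAlg, hκalg, 𝒴, ι, hNq, h𝒴, hiso⟩ :=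
    padicModelSupply N k σ f₀ hf s
  -- (3) the zero pro-class; the implication holds because its conclusion does (the crux at `s`)
  exact ⟨q, hq, κ, hκF, hκC, hκP, hκA, hκAlg, hκalg, 𝒴, 0, s, ι, hNq, h𝒴, hgen, hiso,
    fun _ => hV k σ f₀ hf hirr haff hsm hdim p A hA ⟨s₀, hs₀⟩ s⟩

/-- **`V ⟹ S`**: the crux `Theses.AnchorTransport.VariationalHodge` implies STUB S (specialise the crux to
families base-changed from a countable field over smooth irreducible affine curve bases, then
`arithmeticDiscSupply_of_variationalHodgeDescended`). [cite: MaulikPoonen2012, §4] -/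
theorem arithmeticDiscSupply_of_variationalHodge (hV : VariationalHodge) :
    ∀ (N : ℕ) (k : Type) [Field k] [Countable k] (σ : k →+* ℂ) ⦃n : ℕ⦄ ⦃𝒳₀ S₀ : SchemeOver k⦄
      (f₀ : 𝒳₀ ⟶ S₀),
      IsSmoothProjectiveFamily ((baseChangeHom σ).map f₀) n →
      IrreducibleSpace ((baseChangeHom σ).obj S₀).left → IsAffine ((baseChangeHom σ).obj S₀).left →
      AlgebraicGeometry.Smooth ((baseChangeHom σ).obj S₀).hom →
      topologicalKrullDim ((baseChangeHom σ).obj S₀).left = 1 →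
      ∀ (p : ℕ) (A : complexBetti ((baseChangeHom σ).obj 𝒳₀) (2 * p)),
      (∀ s : ComplexPoints ((baseChangeHom σ).obj S₀),
        IsRationalClass (complexBetti.map (fiberι ((baseChangeHom σ).map f₀) s) (2 * p) A) ∧
        IsOfHodgeType n (fiberOver ((baseChangeHom σ).map f₀) s) (2 * p) p p
          (complexBetti.map (fiberι ((baseChangeHom σ).map f₀) s) (2 * p) A)) →
      ∀ s₀ : ComplexPoints ((baseChangeHom σ).obj S₀),
        complexBetti.map (fiberι ((baseChangeHom σ).map f₀) s₀) (2 * p) A ∈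
          algebraicClasses (fiberOver ((baseChangeHom σ).map f₀) s₀) p →
      ∃ (q : ℕ) (_ : Fact q.Prime) (κ : Type) (_ : Field κ) (_ : CharP κ q) (_ : PerfectRing κ q)
        (_ : IsAlgClosed κ) (_ : Algebra (ZMod q) κ) (_ : Algebra.IsAlgebraic (ZMod q) κ)
        (𝒴 : SchemeOver (WittVector q κ))
        (ξ : ContinuousKZeroRat (Ideal.span {(q : WittVector q κ)}) 𝒴)
        (s : ComplexPoints ((baseChangeHom σ).obj S₀)) (ι : K(q, κ) →+* ℂ),
        N ≤ q ∧ WittScheme.IsSmoothProperModel n 𝒴 ∧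
        (∀ Z : Set (ComplexPoints ((baseChangeHom σ).obj S₀)),
          IsDefinedOver σ S₀ σ.fieldRange Z → s ∈ Z → Z = Set.univ) ∧
        Nonempty ((baseChangeHom ι).obj (WittScheme.genericFibre 𝒴) ≅
          fiberOver ((baseChangeHom σ).map f₀) s) ∧
        ((∃ η : KZeroRat 𝒴.left,
          KZeroRat.map (WittScheme.specialFibreι 𝒴) η =
            KZeroRat.map (specialFibreToTower 𝒴)
              (ContinuousKZeroRat.specialFibre (Ideal.span {(q : WittVector q κ)}) 𝒴 ξ)) →
          complexBetti.map (fiberι ((baseChangeHom σ).map f₀) s) (2 * p) A ∈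
            algebraicClasses (fiberOver ((baseChangeHom σ).map f₀) s) p) :=
  arithmeticDiscSupply_of_variationalHodgeDescended
    fun _ _ _ _ _ _ _ _ hf hirr _ hsm _ p A hA hs₀ s => hV _ hf hirr hsm p A hA hs₀ s

/-- **`HC ⟹ S`**: the Hodge conjecture implies STUB S (through `variationalHodge_of_hodgeConjecture`,
Charles–Schnell Cor. 11.3.6, and `arithmeticDiscSupply_of_variationalHodge`) — S is HC-sandwiched on the
positive side, so it is not refutable without refuting HC. [cite: CharlesSchnell2014Notes, Cor. 11.3.6] -/
theorem arithmeticDiscSupply_of_hodgeConjecture (hHC : _root_.HodgeConjecture) :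
    ∀ (N : ℕ) (k : Type) [Field k] [Countable k] (σ : k →+* ℂ) ⦃n : ℕ⦄ ⦃𝒳₀ S₀ : SchemeOver k⦄
      (f₀ : 𝒳₀ ⟶ S₀),
      IsSmoothProjectiveFamily ((baseChangeHom σ).map f₀) n →
      IrreducibleSpace ((baseChangeHom σ).obj S₀).left → IsAffine ((baseChangeHom σ).obj S₀).left →
      AlgebraicGeometry.Smooth ((baseChangeHom σ).obj S₀).hom →
      topologicalKrullDim ((baseChangeHom σ).obj S₀).left = 1 →
      ∀ (p : ℕ) (A : complexBetti ((baseChangeHom σ).obj 𝒳₀) (2 * p)),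
      (∀ s : ComplexPoints ((baseChangeHom σ).obj S₀),
        IsRationalClass (complexBetti.map (fiberι ((baseChangeHom σ).map f₀) s) (2 * p) A) ∧
        IsOfHodgeType n (fiberOver ((baseChangeHom σ).map f₀) s) (2 * p) p p
          (complexBetti.map (fiberι ((baseChangeHom σ).map f₀) s) (2 * p) A)) →
      ∀ s₀ : ComplexPoints ((baseChangeHom σ).obj S₀),
        complexBetti.map (fiberι ((baseChangeHom σ).map f₀) s₀) (2 * p) A ∈
          algebraicClasses (fiberOver ((baseChangeHom σ).map f₀) s₀) p →
      ∃ (q : ℕ) (_ : Fact q.Prime) (κ : Type) (_ : Field κ) (_ : CharP κ q) (_ : PerfectRing κ q)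
        (_ : IsAlgClosed κ) (_ : Algebra (ZMod q) κ) (_ : Algebra.IsAlgebraic (ZMod q) κ)
        (𝒴 : SchemeOver (WittVector q κ))
        (ξ : ContinuousKZeroRat (Ideal.span {(q : WittVector q κ)}) 𝒴)
        (s : ComplexPoints ((baseChangeHom σ).obj S₀)) (ι : K(q, κ) →+* ℂ),
        N ≤ q ∧ WittScheme.IsSmoothProperModel n 𝒴 ∧
        (∀ Z : Set (ComplexPoints ((baseChangeHom σ).obj S₀)),
          IsDefinedOver σ S₀ σ.fieldRange Z → s ∈ Z → Z = Set.univ) ∧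
        Nonempty ((baseChangeHom ι).obj (WittScheme.genericFibre 𝒴) ≅
          fiberOver ((baseChangeHom σ).map f₀) s) ∧
        ((∃ η : KZeroRat 𝒴.left,
          KZeroRat.map (WittScheme.specialFibreι 𝒴) η =
            KZeroRat.map (specialFibreToTower 𝒴)
              (ContinuousKZeroRat.specialFibre (Ideal.span {(q : WittVector q κ)}) 𝒴 ξ)) →
          complexBetti.map (fiberι ((baseChangeHom σ).map f₀) s) (2 * p) A ∈
            algebraicClasses (fiberOver ((baseChangeHom σ).map f₀) s) p) :=
  arithmeticDiscSupply_of_variationalHodge (variationalHodge_of_hodgeConjecture hHC)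

/-- **Granted the p-adic bet P, the variational Hodge conjecture is EQUIVALENT to the arithmetic disc
statement S** (`→`: `arithmeticDiscSupply_of_variationalHodge`, P unused; `←`: the registered composition
in the kernel, `variationalHodge_of_padic`). [cite: AntieauMathewMorrowNikolaus2022, Conj. 1.3 and Thm. D]
[cite: MaulikPoonen2012, §3–4] -/
theorem variationalHodge_iff_arithmeticDiscSupply_of_padic
    (hP : ∀ d : ℕ, ∃ p₀ : ℕ, ∀ (p : ℕ) [Fact p.Prime], p₀ ≤ p →
      ∀ (κ : Type) [Field κ] [CharP κ p] [PerfectRing κ p] [IsAlgClosed κ] [Algebra (ZMod p) κ],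
      Algebra.IsAlgebraic (ZMod p) κ →
      ∀ (𝒴 : SchemeOver (WittVector p κ)), WittScheme.IsSmoothProperModel d 𝒴 →
      ∀ ξ : ContinuousKZeroRat (Ideal.span {(p : WittVector p κ)}) 𝒴,
        ∃ η : KZeroRat 𝒴.left,
          KZeroRat.map (WittScheme.specialFibreι 𝒴) η =
            KZeroRat.map (specialFibreToTower 𝒴)
              (ContinuousKZeroRat.specialFibre (Ideal.span {(p : WittVector p κ)}) 𝒴 ξ)) :
    VariationalHodge ↔
    ∀ (N : ℕ) (k : Type) [Field k] [Countable k] (σ : k →+* ℂ) ⦃n : ℕ⦄ ⦃𝒳₀ S₀ : SchemeOver k⦄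
      (f₀ : 𝒳₀ ⟶ S₀),
      IsSmoothProjectiveFamily ((baseChangeHom σ).map f₀) n →
      IrreducibleSpace ((baseChangeHom σ).obj S₀).left → IsAffine ((baseChangeHom σ).obj S₀).left →
      AlgebraicGeometry.Smooth ((baseChangeHom σ).obj S₀).hom →
      topologicalKrullDim ((baseChangeHom σ).obj S₀).left = 1 →
      ∀ (p : ℕ) (A : complexBetti ((baseChangeHom σ).obj 𝒳₀) (2 * p)),
      (∀ s : ComplexPoints ((baseChangeHom σ).obj S₀),
        IsRationalClass (complexBetti.map (fiberι ((baseChangeHom σ).map f₀) s) (2 * p) A) ∧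
        IsOfHodgeType n (fiberOver ((baseChangeHom σ).map f₀) s) (2 * p) p p
          (complexBetti.map (fiberι ((baseChangeHom σ).map f₀) s) (2 * p) A)) →
      ∀ s₀ : ComplexPoints ((baseChangeHom σ).obj S₀),
        complexBetti.map (fiberι ((baseChangeHom σ).map f₀) s₀) (2 * p) A ∈
          algebraicClasses (fiberOver ((baseChangeHom σ).map f₀) s₀) p →
      ∃ (q : ℕ) (_ : Fact q.Prime) (κ : Type) (_ : Field κ) (_ : CharP κ q) (_ : PerfectRing κ q)
        (_ : IsAlgClosed κ) (_ : Algebra (ZMod q) κ) (_ : Algebra.IsAlgebraic (ZMod q) κ)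
        (𝒴 : SchemeOver (WittVector q κ))
        (ξ : ContinuousKZeroRat (Ideal.span {(q : WittVector q κ)}) 𝒴)
        (s : ComplexPoints ((baseChangeHom σ).obj S₀)) (ι : K(q, κ) →+* ℂ),
        N ≤ q ∧ WittScheme.IsSmoothProperModel n 𝒴 ∧
        (∀ Z : Set (ComplexPoints ((baseChangeHom σ).obj S₀)),
          IsDefinedOver σ S₀ σ.fieldRange Z → s ∈ Z → Z = Set.univ) ∧
        Nonempty ((baseChangeHom ι).obj (WittScheme.genericFibre 𝒴) ≅
          fiberOver ((baseChangeHom σ).map f₀) s) ∧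
        ((∃ η : KZeroRat 𝒴.left,
          KZeroRat.map (WittScheme.specialFibreι 𝒴) η =
            KZeroRat.map (specialFibreToTower 𝒴)
              (ContinuousKZeroRat.specialFibre (Ideal.span {(q : WittVector q κ)}) 𝒴 ξ)) →
          complexBetti.map (fiberι ((baseChangeHom σ).map f₀) s) (2 * p) A ∈
            algebraicClasses (fiberOver ((baseChangeHom σ).map f₀) s) p) :=
  ⟨arithmeticDiscSupply_of_variationalHodge, fun hS => variationalHodge_of_padic hP hS⟩

end Sandwich

end Summit.HodgeConjecture.HodgeConjecture.Theorems

end
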